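import Literature.Computability.Complexity.SparseSetsUpwardSeparationNE
import Literature.Computability.Complexity.SparseSetsUpwardSeparationCensus
import Literature.Computability.Complexity.SparseSetsUpwardSeparationChains
import Literature.Computability.MetaComplexity.AvgCaseTallyNE
import HarnessLib

/-!
# Hartmanis–Immerman–Sewelson 1985, Theorem 1: a sparse set in `NP − P` exists iff `E ≠ NE` (proof)

Topic `Literature/Computability/Complexity`; discharge of the named fact
`hartmanisImmermanSewelson1985_thm1` of `SparseSetsUpwardSeparation.lean` (the assembly file
announced as "`…Proofs.lean`" in the docstrings of `…Codes/Census/Chains.lean`; the sibling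
`SparseSetsUpwardSeparationProofs.lean` holds the independent discharge of `book1974_thm1`):

* **`hartmanisImmermanSewelson1985_thm1_holds`** —
  `(∃ S, IsSparseLanguage S ∧ S ∈ NP ∧ S ∉ P) ↔ E ≠ NE`.

Following the printed proof (Information and Control 65, pp. 163–164):

* (⇐, p. 163) "`A ∈ NEXPTIME − EXPTIME` … convert `A` to tally notation … `TALLY(A) ∈ NP − P`"
  (Book 1974): the tree's tally translation `AvgTallyNE.tallyLang` (`AvgCaseTallyNE.lean`: for
  `L ∈ NTIME(2^{an})` the tally language `T(L) = {1^{tnum x} | x ∈ L}` is in `NP`, and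
  `x ∈ L ↔ 1^{tnum x} ∈ T(L)`); `T(L)` is sparse (one word per length), and if it were in `P` then
  `L = pad⁻¹(T(L)) ∈ E` for the `2^{O(n)}`-time pad `x ↦ 1^{tnum x}` (`preimage_mem_E`) — so
  "every sparse `NP` set is in `P`" gives `NE ⊆ E`, and `E ⊆ NE` always (`E_subset_NE`):
  `UpSep.E_eq_NE_of_sparse_NP_subset_P`.
* (⇒, pp. 163–164, the upward separation method) `E = NE` and `S ∈ NP` sparse ⟹ `S ∈ P`:
  `UpSep.mem_P_of_isSparseLanguage_of_E_eq_NE`. The census language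
  `S' = decodeFn⁻¹(padLang S)` (`…Codes.lean`, `…Census.lean`) is in `NE = E`
  (`preimage_mem_NE_of_mem_FE`, `…NE.lean`), so its query languages along the logarithmically short
  maps `digitQueryFn`, `censusFn` are in `P` (`preimage_mem_P_of_mem_E`); and
  `S = ∃ i < nᶜ+c+1 · [¬ S'(n, i+1, 0, n, 0)] ∧ ∃ j · ∀ k · S'(n, i, j, k, x[k])` — in `P` by the
  bounded-quantifier closures `bexLang_mem_P`/`ballLang_mem_P` — by the census formula
  `UpSep.mem_iff_census` (`…Chains.lean`) and sparseness (`census < nᶜ + c + 1`).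

## References

* J. Hartmanis, N. Immerman, V. Sewelson, *Sparse sets in NP−P: EXPTIME versus NEXPTIME*,
  Information and Control 65 (1985) 158–181, Thm. 1 (p. 163) and its proof (pp. 163–164);
  definitions p. 162 (held: `paper:doi-10-1016-s0019-9958-85-80004-8`, PDF pp. 5–7).
  [HartmanisImmermanSewelson1985]
* R. V. Book, *Tally languages and complexity classes*, Information and Control 26 (1974) 186–193,
  Thm. 1. [Book1974]
-/

noncomputable section

namespace Literature.Computability.Complexity

open _root_.Computability Polynomial OracleCompose PRelSigPi
open Literature.Barriers.PneNP (IsSparseLanguage)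

namespace UpSep

/-! ### `E = NE` puts every sparse `NP` set into `P` (the upward separation method) -/

section Census

variable {S : Language Bool}

/-- **The census language answers the census predicate on binary names**:
`code n i j k d ∈ decodeFn⁻¹(padLang S) ↔ Cens S n i j k d`. [cite: HartmanisImmermanSewelson1985, Theorem 1 (proof, p. 163)] -/
theorem code_mem_censusLang_iff (n i j k : ℕ) (d : Bool) :
    code n i j k d ∈ (decodeFn ⁻¹' padLang S : Language Bool) ↔ Cens S n i j k d := by
  change decodeFn (code n i j k d) ∈ padLang S ↔ _
  rw [decodeFn_code, ucode_mem_padLang_iff]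

/-- **The polynomial-time formula.** For the census language `S'` of `S` and a bound `q₀`, the
language `∃ i < q₀(|x|) · [⟨x, 1ⁱ⟩ ∉ censusFn⁻¹(S')] ∧ ∃ j · ∀ k · ⟨⟨⟨x, 1ⁱ⟩, 1ʲ⟩, 1ᵏ⟩ ∈ digitQueryFn⁻¹(S')`
(bounded quantifiers `bexLang`/`ballLang`) unfolds to the census formula of `mem_iff_census`.
[cite: HartmanisImmermanSewelson1985, Theorem 1 (proof, p. 164)] -/
theorem mem_formulaLang_iff (q₀ : Polynomial ℕ) (x : List Bool) :
    x ∈ bexLang q₀ ((censusFn ⁻¹' (decodeFn ⁻¹' padLang S))ᶜ ⊓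
        bexLang (X + 1) (ballLang (X + 1) (digitQueryFn ⁻¹' (decodeFn ⁻¹' padLang S)))) ↔
      ∃ i < q₀.eval x.length, ¬ Cens S x.length (i + 1) 0 x.length false ∧
        ∃ j < 2 * x.length + 2 + i + 1, ∀ k < 2 * (2 * x.length + 2 + i) + 2 + j + 1,
          Cens S x.length i j k (x.getD k false) := by
  rw [mem_bexLang]
  refine exists_congr fun i => and_congr_right fun _ => ?_
  change (¬ censusFn (boolPair x (List.replicate i true)) ∈ (decodeFn ⁻¹' padLang S : Language Bool) ∧
    boolPair x (List.replicate i true) ∈ bexLang (X + 1)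
      (ballLang (X + 1) (digitQueryFn ⁻¹' (decodeFn ⁻¹' padLang S)))) ↔ _
  rw [censusFn_apply, code_mem_censusLang_iff, mem_bexLang]
  simp only [length_boolPair, List.length_replicate, eval_add, eval_X, eval_one, mem_ballLang]
  refine and_congr_right fun _ => exists_congr fun j => and_congr_right fun _ =>
    forall_congr' fun k => imp_congr_right fun _ => ?_
  change digitQueryFn (boolPair (boolPair (boolPair x (List.replicate i true)) (List.replicate j true))
    (List.replicate k true)) ∈ (decodeFn ⁻¹' padLang S : Language Bool) ↔ _
  rw [digitQueryFn_apply, code_mem_censusLang_iff]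

/-- **Hartmanis–Immerman–Sewelson 1985, Thm. 1 (⇒ half): if `E = NE` then every sparse `NP` set is
in `P`** ("Conversely, suppose that `EXPTIME = NEXPTIME`. We shall then show that every sparse `NP`
set is in `P`", p. 163). The census language `S' = decodeFn⁻¹(padLang S)` is in `NE = E`
(`padLang_mem_NP`, `decodeFn_mem_FE`, `preimage_mem_NE_of_mem_FE`); the query languages along the
logarithmically short `censusFn`, `digitQueryFn` are in `P` (`preimage_mem_P_of_mem_E`); the formula
language is in `P` (`bexLang_mem_P`, `ballLang_mem_P`, complement, intersection) and equals `S`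
(`mem_iff_census` with `q₀ = X^c + c + 1 >` census, by sparseness).
[cite: HartmanisImmermanSewelson1985, Theorem 1 (proof, pp. 163–164)] -/
theorem mem_P_of_isSparseLanguage_of_E_eq_NE (hE : E = NE) (hS : S ∈ Nondeterministic.NP)
    (hsp : IsSparseLanguage S) : S ∈ Classes.P := by
  obtain ⟨c, hc⟩ := hsp
  have hpad := padLang_mem_NP hS
  have hQ : (digitQueryFn ⁻¹' (decodeFn ⁻¹' padLang S) : Language Bool) ∈ Classes.P :=
    preimage_preimage_mem_P_of_E_eq_NE hE hpad decodeFn_mem_FE digitQueryFn_mem_FP 17 fun w =>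
      (length_digitQueryFn_le w).trans (by omega)
  have hlog : ∀ n : ℕ, Nat.log 2 (n + 1) ≤ Nat.log 2 n + 1 := fun n => by
    rcases Nat.eq_zero_or_pos n with rfl | hn
    · simp
    · calc Nat.log 2 (n + 1) ≤ Nat.log 2 (n * 2) := Nat.log_mono_right (by omega)
        _ = Nat.log 2 n + 1 := Nat.log_mul_base (by norm_num) hn.ne'
  have hC : (censusFn ⁻¹' (decodeFn ⁻¹' padLang S) : Language Bool) ∈ Classes.P :=
    preimage_preimage_mem_P_of_E_eq_NE hE hpad decodeFn_mem_FE censusFn_mem_FP 25 fun w =>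
      (length_censusFn_le w).trans (by have := hlog w.length; omega)
  have hP : bexLang (X ^ c + Polynomial.C c + 1) ((censusFn ⁻¹' (decodeFn ⁻¹' padLang S))ᶜ ⊓
      bexLang (X + 1) (ballLang (X + 1) (digitQueryFn ⁻¹' (decodeFn ⁻¹' padLang S)))) ∈ Classes.P :=
    bexLang_mem_P _ (inter_mem_P (compl_mem_P_iff.2 hC) (bexLang_mem_P _ (ballLang_mem_P _ hQ)))
  have heq : S = bexLang (X ^ c + Polynomial.C c + 1) ((censusFn ⁻¹' (decodeFn ⁻¹' padLang S))ᶜ ⊓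
      bexLang (X + 1) (ballLang (X + 1) (digitQueryFn ⁻¹' (decodeFn ⁻¹' padLang S)))) := by
    ext x
    rw [mem_formulaLang_iff]
    simp only [eval_add, eval_pow, eval_X, eval_C, eval_one]
    exact mem_iff_census (B₁ := fun i => 2 * x.length + 2 + i + 1)
      (B₂ := fun i j => 2 * (2 * x.length + 2 + i) + 2 + j + 1)
      (by have := hc x.length; omega) (fun i => by omega) (fun i j => by omega) (fun i j => by omega)
  rw [heq]
  exact hP

end Census

/-! ### The converse: if every sparse `NP` set is in `P` then `E = NE` (tally translation) -/

section Tally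

open Literature.Computability.MetaComplexity (E_subset_NE)
open Literature.Computability.MetaComplexity.AvgTallyNE

/-- **Tally languages are sparse**: the tally language `T(L) ⊆ 1*` has at most one word of each
length (HIS85, p. 158: "tally sets … are a special case of sparse sets").
[cite: HartmanisImmermanSewelson1985, Theorem 1 (proof, p. 163)] -/
theorem isSparseLanguage_tallyLang (L : Language Bool) : IsSparseLanguage (tallyLang L) := by
  refine ⟨1, fun n => ?_⟩
  have hsub : {x : List Bool | x ∈ tallyLang L ∧ x.length = n} ⊆ {List.replicate n true} := by
    rintro x ⟨hx, hlen⟩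
    have h1 : onesFn x = x := hx.1
    rw [Set.mem_singleton_iff, ← h1, onesFn_eq_replicate, hlen]
  calc {x : List Bool | x ∈ tallyLang L ∧ x.length = n}.ncard
      ≤ ({List.replicate n true} : Set (List Bool)).ncard := Set.ncard_le_ncard hsub (Set.finite_singleton _)
    _ = 1 := Set.ncard_singleton _
    _ ≤ n ^ 1 + 1 := by omega

/-! The **tally code** `x ↦ 1^{tnum x}` ("prefix each string in `A` by a `1` and interpret these
strings as binary representations of integers, then … `TALLY(A) = {1ⁿ | 1n ∈ A}`", p. 163; here
`tnum x = ⟦x1⟧₂`, least significant bit first, as in `AvgCaseTallyNE.lean`) is the composite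
`binToUnaryFn ∘ mapFstFn (expPad 1) ∘ copyFn ∘ (· ++ [1])` — the pieces of `AvgTallyNE.tallyPadFn`
without its final copy: append the leading bit, copy, expand one copy to the ruler `expPad 1`, convert
the numeral to unary against it. It is written out in full below (no definition is introduced). -/

/-- **Value of the tally code**: `x ↦ 1^{tnum x}`. [cite: HartmanisImmermanSewelson1985, Theorem 1 (proof, p. 163)] -/
theorem tallyCodeFn_apply (x : List Bool) :
    (binToUnaryFn ∘ (mapFstFn (expPad 1) ∘ (copyFn ∘ fun x : List Bool => x ++ [true]))) x =
      unaryEncodeNat (tnum x) := by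
  have hmin : min (bitsToNat (x ++ [true])) (expPad 1 (x ++ [true])).length = tnum x := by
    rw [length_expPad, pow_one, List.length_append, List.length_singleton]
    exact min_eq_left (by have := tnum_lt x; unfold tnum at *; omega)
  simp only [Function.comp_apply, copyFn_apply, mapFstFn_boolPair, binToUnaryFn_boolPair, hmin,
    unaryEncodeNat_eq_replicate]

/-- **The tally code is computable in time `2^{O(n)}`** (as `AvgTallyNE.tallyPadFn_mem_FE`).
[cite: HartmanisImmermanSewelson1985, Theorem 1 (proof, p. 163)] -/
theorem tallyCodeFn_mem_FE :
    (binToUnaryFn ∘ (mapFstFn (expPad 1) ∘ (copyFn ∘ fun x : List Bool => x ++ [true]))) ∈ FE := by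
  refine comp_mem_FE binToUnaryFn_mem_FP ?_
  refine comp_mem_FE_of_linear (mapFstFn_mem_FE expPad_one_mem_FE)
    (comp_mem_FP copyFn_mem_FP (append_mem_FP OracleCompose.id_mem_FP (const_mem_FP [true]))) 5
    fun w => ?_
  simp only [Function.comp_apply, copyFn_apply, length_boolPair, List.length_append,
    List.length_singleton]
  omega

/-- **If the tally language of `L` is in `P` then `L ∈ E`** ("Since `A` is in `NEXPTIME` and not in
`EXPTIME`, `TALLY(A) ∈ NP − P`", p. 163, contraposed): `L` is the preimage of `T(L)` under the
tally code (`mem_iff_unaryEncodeNat_tnum_mem_tallyLang`), which is in `FE` (`preimage_mem_E`).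
[cite: HartmanisImmermanSewelson1985, Theorem 1 (proof, p. 163)] -/
theorem mem_E_of_tallyLang_mem_P {L : Language Bool} (hT : tallyLang L ∈ Classes.P) : L ∈ E := by
  have hLeq : L = (binToUnaryFn ∘ (mapFstFn (expPad 1) ∘ (copyFn ∘ fun x : List Bool => x ++ [true]))) ⁻¹'
      tallyLang L := by
    ext x
    change x ∈ L ↔
      (binToUnaryFn ∘ (mapFstFn (expPad 1) ∘ (copyFn ∘ fun x : List Bool => x ++ [true]))) x ∈ tallyLang L
    rw [tallyCodeFn_apply]
    exact mem_iff_unaryEncodeNat_tnum_mem_tallyLang L x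
  rw [hLeq]
  exact preimage_mem_E tallyCodeFn_mem_FE hT

/-- **Hartmanis–Immerman–Sewelson 1985, Thm. 1 (⇐ half, after Book 1974): if every sparse `NP` set is
in `P` then `E = NE`.** For `L ∈ NTIME(2^{an})` the tally language `T(L)` is a sparse `NP` set
(`tallyLang_mem_NP`, `isSparseLanguage_tallyLang`), hence in `P`, so `L ∈ E`
(`mem_E_of_tallyLang_mem_P`); with `E ⊆ NE` (`E_subset_NE`).
[cite: HartmanisImmermanSewelson1985, Theorem 1 (proof, p. 163)] -/
theorem E_eq_NE_of_sparse_NP_subset_P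
    (h : ∀ S : Language Bool, IsSparseLanguage S → S ∈ Nondeterministic.NP → S ∈ Classes.P) : E = NE := by
  refine Set.Subset.antisymm E_subset_NE fun L hL => ?_
  simp only [NE, Set.mem_iUnion] at hL
  obtain ⟨a, ha⟩ := hL
  exact mem_E_of_tallyLang_mem_P (h _ (isSparseLanguage_tallyLang L) (tallyLang_mem_NP ha))

end Tally

end UpSep

/-! ### The named fact -/

/-- **Discharge of `hartmanisImmermanSewelson1985_thm1`** (Hartmanis–Immerman–Sewelson 1985,
Theorem 1, Information and Control 65, p. 163: "There exists a sparse set `S` in `NP − P` if and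
only if `EXPTIME ≠ NEXPTIME`", with `EXPTIME = ⋃_c TIME[2^{cn}] = E`, `NEXPTIME = ⋃_c NTIME[2^{cn}] = NE`,
p. 162). (⇒) by `UpSep.mem_P_of_isSparseLanguage_of_E_eq_NE` (the upward separation method,
pp. 163–164); (⇐) by `UpSep.E_eq_NE_of_sparse_NP_subset_P` (tally translation, p. 163 / Book 1974).
[cite: HartmanisImmermanSewelson1985, Theorem 1 (p. 163)] -/
theorem hartmanisImmermanSewelson1985_thm1_holds : hartmanisImmermanSewelson1985_thm1 := by
  constructor
  · rintro ⟨S, hsp, hNP, hP⟩ hE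
    exact hP (UpSep.mem_P_of_isSparseLanguage_of_E_eq_NE hE hNP hsp)
  · intro hne
    by_contra h
    push Not at h
    exact hne (UpSep.E_eq_NE_of_sparse_NP_subset_P h)

end Literature.Computability.Complexity
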